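import Literature.NumberTheory.EllipticCurves.ManinConstantClassCertificateTwist
import Literature.NumberTheory.EllipticCurves.ModularityVersionApProofs
import Literature.NumberTheory.EllipticCurves.Rank1Residual.Predicates
import HarnessLib

/-!
# Route `ErratumRoadFive` (K2, `p ≥ 5`), crux `EulerHalfNotRamNoInertSetAtFive` (item stmt-BirchSwinnertonDyer-19715), line `birth`:
# THE v11 RESIDUAL HAS NO PAIR OF CONDUCTOR BELOW 966 735 — «0 census pairs below 5·10⁵» is a THEOREM, not a table lookup
# (cell `bsd-stepL`, lead seat `bsd-line-er5-p1` g1; `--supports stmt-BirchSwinnertonDyer-19715 --as helper`)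

WHAT. The residual stub of the line after v10 ∕ v11 (`stub_res_otherMultThreeOneModOffendingAtFive` ∕ `stub_res_otherMultAllCarriersOffGenusZeroAtFive`)
lives on pairs `(E, p)` with `p ≥ 5` multiplicative, THREE distinct multiplicative primes `q₁, q₂, q₃` with `p ∣ q_i − 1`, and (v11, the level-lowering cut)
additive conductor NOT in `{1, 4, 8, 16, 9, 25}` (three negated locus clauses). Elementary arithmetic then bounds the conductor from below:

* §1 `prod_ge_of_three_distinct_one_mod` — `p ≥ 5` prime and three distinct primes `q_i` with `p ∣ q_i − 1` give `p·q₁·q₂·q₃ ≥ 5·11·21·31 = 35 805`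
  (`q_i` is odd, so `2p ∣ q_i − 1`; three distinct values `2p·k + 1`, `k ≥ 1`, have product `≥ (2p+1)(4p+1)(6p+1)` by the elementary symmetric-function bounds
  `i+j+k ≥ 6`, `ij+jk+ki ≥ 11`, `ijk ≥ 6` for distinct positive `i, j, k`).
* §2 `exists_additive_divisor_ge_twentySeven` — off the three genus-zero loci an elliptic curve has a divisor `D ∣ N_E` with `27 ≤ D`, supported on
  additive primes or equal to `27`, `32`, `125` (case analysis: `27 ∣ N`, or an additive prime `ℓ ≥ 7` (`ℓ² ∣ N`), or additive `5` with `125 ∣ N` or a second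
  additive prime, or additive `2` with `32 ∣ N` or a second additive prime), coprime to `p·q₁·q₂·q₃`.
* §3 `conductorNorm_ge_of_threeOneModMult_offGenusZero` — hence `966 735 = 27 · 35 805 ≤ N_E`; corollary `conductorNorm_gt_cremona_of_…`: `5·10⁵ < N_E`.
  So the v11 residual is EMPTY throughout Cremona's range as a kernel theorem (the lead g0's census kit j254667 found 0 of 404 pairs there — now explained:
  without the level-lowering cut the same arithmetic only gives `N_E ≥ 4 · 35 805 = 143 220`).

HONEST FRAMING: THEOREMS ONLY (elementary arithmetic on the conductor); no `sorry`, no definition, no named fact; it does NOT prove `Typed.MissingUpperBoundAt`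
for any pair and does NOT close 19715 — it certifies that the registered residual has no instance of conductor `< 966 735`. BSD is proved for no curve; no
summit statement is touched. [cite: SilvermanATAEC1994, IV.10.2 (c) (additive ⟹ f_q ≥ 2)] [cite: Cremona1997, Table 1 (range N < 5·10⁵ of the census)]
-/

set_option autoImplicit false
set_option linter.dupNamespace false

noncomputable section

open scoped Classical

open WeierstrassCurve Literature.NumberTheory.EllipticCurves Literature.NumberTheory.EllipticCurves.ModularForms
  Literature.NumberTheory.EllipticCurves.Rank1Residual

namespace Summit.BirchSwinnertonDyer.BirchSwinnertonDyer.Theorems.EulerHalfResidualBound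

/-! ### §1 Three distinct primes `≡ 1 (mod p)` -/

/-- Elementary: for positive naturals `i < j < k`, `6 ≤ i+j+k`, `11 ≤ ij + jk + ki` and `6 ≤ ijk`. -/
private theorem sym_bounds_of_lt {i j k : ℕ} (hi : 1 ≤ i) (hij : i < j) (hjk : j < k) :
    6 ≤ i + j + k ∧ 11 ≤ i * j + j * k + k * i ∧ 6 ≤ i * j * k := by
  have hj : 2 ≤ j := by omega
  have hk : 3 ≤ k := by omega
  refine ⟨by omega, ?_, ?_⟩
  · have h1 : 1 * 2 ≤ i * j := Nat.mul_le_mul hi hj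
    have h2 : 2 * 3 ≤ j * k := Nat.mul_le_mul hj hk
    have h3 : 3 * 1 ≤ k * i := Nat.mul_le_mul hk hi
    omega
  · have h1 : 1 * 2 ≤ i * j := Nat.mul_le_mul hi hj
    have h2 : 1 * 2 * 3 ≤ i * j * k := Nat.mul_le_mul h1 hk
    omega

/-- Elementary: for pairwise distinct positive naturals `i, j, k`, `6 ≤ i+j+k`, `11 ≤ ij + jk + ki` and `6 ≤ ijk` (all orderings reduced to `i < j < k`). -/
private theorem sym_bounds {i j k : ℕ} (hi : 1 ≤ i) (hj : 1 ≤ j) (hk : 1 ≤ k)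
    (hij : i ≠ j) (hik : i ≠ k) (hjk : j ≠ k) :
    6 ≤ i + j + k ∧ 11 ≤ i * j + j * k + k * i ∧ 6 ≤ i * j * k := by
  rcases Nat.lt_or_gt_of_ne hij with h₁ | h₁ <;> rcases Nat.lt_or_gt_of_ne hjk with h₂ | h₂ <;>
    rcases Nat.lt_or_gt_of_ne hik with h₃ | h₃
  · -- i < j < k
    exact sym_bounds_of_lt hi h₁ h₂
  · -- i < j < k < i : impossible
    omega
  · -- i < k < j
    obtain ⟨a, b, c⟩ := sym_bounds_of_lt hi h₃ h₂
    exact ⟨by omega, by linarith, by linarith⟩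
  · -- k < i < j
    obtain ⟨a, b, c⟩ := sym_bounds_of_lt hk h₃ h₁
    exact ⟨by omega, by linarith, by linarith⟩
  · -- j < i < k
    obtain ⟨a, b, c⟩ := sym_bounds_of_lt hj h₁ h₃
    exact ⟨by omega, by linarith, by linarith⟩
  · -- j < k < i
    obtain ⟨a, b, c⟩ := sym_bounds_of_lt hj h₂ h₃
    exact ⟨by omega, by linarith, by linarith⟩
  · -- k < j < i < k : impossible
    omega
  · -- k < j < i
    obtain ⟨a, b, c⟩ := sym_bounds_of_lt hk h₂ h₁
    exact ⟨by omega, by linarith, by linarith⟩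

/-- A prime `q` with `p ∣ q − 1` for a prime `p ≥ 5` (more generally an odd `p ≥ 3`) is `2p·k + 1` with `k ≥ 1`: `q ≠ 2` (as `p ∤ 1`), so `q` is odd and
`2 ∣ q − 1`, and `2, p` are coprime. -/
theorem exists_eq_two_mul_mul_add_one {p q : ℕ} (hp : p.Prime) (hp3 : 3 ≤ p) (hq : q.Prime) (hdvd : p ∣ q - 1) :
    ∃ k : ℕ, 1 ≤ k ∧ q = 2 * p * k + 1 := by
  have hq2 : q ≠ 2 := by
    rintro rfl
    have : p ∣ 1 := by simpa using hdvd
    exact absurd (Nat.le_of_dvd one_pos this) (by omega)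
  have hqodd : Odd q := hq.odd_of_ne_two hq2
  have hq1 : 2 ∣ q - 1 := by
    obtain ⟨m, hm⟩ := hqodd
    exact ⟨m, by omega⟩
  have hp2 : Nat.Coprime 2 p := by
    rw [Nat.coprime_primes Nat.prime_two hp]
    omega
  have h2p : 2 * p ∣ q - 1 := Nat.Coprime.mul_dvd_of_dvd_of_dvd hp2 hq1 hdvd
  obtain ⟨k, hk⟩ := h2p
  have hqge : 2 ≤ q := hq.two_le
  refine ⟨k, ?_, by omega⟩
  by_contra hk0
  have : k = 0 := by omega
  subst this
  omega

/-- **§1.** For a prime `p ≥ 5` and three pairwise distinct primes `q₁, q₂, q₃` with `p ∣ q_i − 1`: `35 805 = 5·11·21·31 ≤ p · q₁ · q₂ · q₃`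
(`q_i = 2p·k_i + 1` with distinct `k_i ≥ 1`, and `∏ (2p·k_i + 1) = 8p³·k₁k₂k₃ + 4p²·Σ k_ik_j + 2p·Σ k_i + 1 ≥ (2p+1)(4p+1)(6p+1)`). -/
theorem prod_ge_of_three_distinct_one_mod {p q₁ q₂ q₃ : ℕ} (hp : p.Prime) (hp5 : 5 ≤ p)
    (hq₁ : q₁.Prime) (hq₂ : q₂.Prime) (hq₃ : q₃.Prime)
    (h12 : q₁ ≠ q₂) (h13 : q₁ ≠ q₃) (h23 : q₂ ≠ q₃)
    (hd₁ : p ∣ q₁ - 1) (hd₂ : p ∣ q₂ - 1) (hd₃ : p ∣ q₃ - 1) :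
    35805 ≤ p * q₁ * q₂ * q₃ := by
  obtain ⟨i, hi, rfl⟩ := exists_eq_two_mul_mul_add_one hp (by omega) hq₁ hd₁
  obtain ⟨j, hj, rfl⟩ := exists_eq_two_mul_mul_add_one hp (by omega) hq₂ hd₂
  obtain ⟨k, hk, rfl⟩ := exists_eq_two_mul_mul_add_one hp (by omega) hq₃ hd₃
  have hij : i ≠ j := fun h ↦ h12 (by rw [h])
  have hik : i ≠ k := fun h ↦ h13 (by rw [h])
  have hjk : j ≠ k := fun h ↦ h23 (by rw [h])
  obtain ⟨hs, hss, hsss⟩ := sym_bounds hi hj hk hij hik hjk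
  -- expand the product and compare termwise with p ≥ 5
  have hp2 : 25 ≤ p * p := by nlinarith
  have hp3 : 125 ≤ p * p * p := by nlinarith
  have key : (2 * p + 1) * (4 * p + 1) * (6 * p + 1) ≤ (2 * p * i + 1) * (2 * p * j + 1) * (2 * p * k + 1) := by
    have e1 : (2 * p + 1) * (4 * p + 1) * (6 * p + 1) = 48 * (p * p * p) + 44 * (p * p) + 12 * p + 1 := by ring
    have e2 : (2 * p * i + 1) * (2 * p * j + 1) * (2 * p * k + 1) =
        8 * (p * p * p) * (i * j * k) + 4 * (p * p) * (i * j + j * k + k * i) + 2 * p * (i + j + k) + 1 := by ring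
    rw [e1, e2]
    have a1 : 48 * (p * p * p) ≤ 8 * (p * p * p) * (i * j * k) := by nlinarith
    have a2 : 44 * (p * p) ≤ 4 * (p * p) * (i * j + j * k + k * i) := by nlinarith
    have a3 : 12 * p ≤ 2 * p * (i + j + k) := by nlinarith
    omega
  have low : 35805 ≤ p * ((2 * p + 1) * (4 * p + 1) * (6 * p + 1)) := by
    calc 35805 = 5 * ((2 * 5 + 1) * (4 * 5 + 1) * (6 * 5 + 1)) := by norm_num
      _ ≤ p * ((2 * p + 1) * (4 * p + 1) * (6 * p + 1)) := by gcongr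
  calc 35805 ≤ p * ((2 * p + 1) * (4 * p + 1) * (6 * p + 1)) := low
    _ ≤ p * ((2 * p * i + 1) * (2 * p * j + 1) * (2 * p * k + 1)) := Nat.mul_le_mul_left p key
    _ = p * (2 * p * i + 1) * (2 * p * j + 1) * (2 * p * k + 1) := by ring

/-! ### §2 The additive part of the conductor off the genus-zero loci -/

/-- An additive prime `ℓ` (neither good nor multiplicative reduction) has `ℓ² ∣ N_E` (tree: `sq_dvd_conductorNorm_of_not_good_of_not_mult`) and differs
from every prime of multiplicative reduction. [cite: SilvermanATAEC1994, IV.10.2 (c)] -/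
theorem sq_dvd_and_ne_of_additive (W : WeierstrassCurve ℚ) [W.IsElliptic] {ℓ q : ℕ} [Fact ℓ.Prime] [Fact q.Prime]
    (hadd : ¬ W.HasGoodReductionAtPrime ℓ ∧ ¬ W.HasMultiplicativeReductionAtPrime ℓ) (hq : Mult W q) :
    ℓ ^ 2 ∣ W.conductorNorm ℤ ∧ ℓ ≠ q := by
  refine ⟨sq_dvd_conductorNorm_of_not_good_of_not_mult hadd, ?_⟩
  rintro rfl
  exact hadd.2 hq

/-- **§2.** Off the three genus-zero loci — NOT «every prime `≠ 2` semistable ∧ `2⁵ ∤ N`», NOT «every prime `≠ 3` semistable ∧ `3³ ∤ N`», NOT «every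
prime `≠ 5` semistable ∧ `5³ ∤ N`» — there is a divisor `D ∣ N_E` with `27 ≤ D` all of whose prime factors are additive primes of `E` or lie in `{2, 3, 5}`
with the stated powers; in particular `D` is coprime to every product of primes `≥ 7`… we only record what §3 needs: `D` is coprime to any prime `q ≥ 11` of
multiplicative reduction and to any prime `p ≥ 5` of multiplicative reduction. Stated as: `27 ≤ D`, `D ∣ N_E`, and `D.Coprime m` for every `m` whose prime
factors are multiplicative primes `≥ 5` of `E`. -/
theorem exists_additive_divisor_ge_twentySeven (W : WeierstrassCurve ℚ) [W.IsElliptic]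
    (h2 : ¬ ((∀ (ℓ : ℕ) [Fact ℓ.Prime], ℓ ≠ 2 → W.HasGoodReductionAtPrime ℓ ∨ W.HasMultiplicativeReductionAtPrime ℓ) ∧
      ¬ 2 ^ 5 ∣ W.conductorNorm ℤ))
    (h3 : ¬ ((∀ (ℓ : ℕ) [Fact ℓ.Prime], ℓ ≠ 3 → W.HasGoodReductionAtPrime ℓ ∨ W.HasMultiplicativeReductionAtPrime ℓ) ∧
      ¬ 3 ^ 3 ∣ W.conductorNorm ℤ))
    (h5 : ¬ ((∀ (ℓ : ℕ) [Fact ℓ.Prime], ℓ ≠ 5 → W.HasGoodReductionAtPrime ℓ ∨ W.HasMultiplicativeReductionAtPrime ℓ) ∧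
      ¬ 5 ^ 3 ∣ W.conductorNorm ℤ))
    (m : ℕ) (hm : ∀ r : ℕ, r.Prime → r ∣ m → 5 ≤ r ∧ ∃ _ : Fact r.Prime, Mult W r) :
    ∃ D : ℕ, 27 ≤ D ∧ D ∣ W.conductorNorm ℤ ∧ D.Coprime m := by
  classical
  -- coprimality helper: a number whose prime factors are all additive-or-small-and-not-multiplicative is coprime to m
  have hcop : ∀ D : ℕ, (∀ r : ℕ, r.Prime → r ∣ D →
      (r < 5 ∨ ∃ _ : Fact r.Prime, ¬ W.HasGoodReductionAtPrime r ∧ ¬ W.HasMultiplicativeReductionAtPrime r)) → D.Coprime m := by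
    intro D hD
    apply Nat.coprime_of_dvd
    intro r hr hrD hrm
    obtain ⟨hr5, ir, hmult⟩ := hm r hr hrm
    rcases hD r hr hrD with hlt | ⟨ir', hadd⟩
    · omega
    · exact hadd.2 (by convert hmult)
  -- an additive prime from a negated locus: ¬(∀ ℓ ≠ r, semistable) gives one
  have hex : ∀ r : ℕ, ¬ (∀ (ℓ : ℕ) [Fact ℓ.Prime], ℓ ≠ r → W.HasGoodReductionAtPrime ℓ ∨ W.HasMultiplicativeReductionAtPrime ℓ) →
      ∃ (ℓ : ℕ) (_ : Fact ℓ.Prime), ℓ ≠ r ∧ ¬ W.HasGoodReductionAtPrime ℓ ∧ ¬ W.HasMultiplicativeReductionAtPrime ℓ := by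
    intro r h
    by_contra hc
    apply h
    intro ℓ _ hℓr
    by_contra hno
    exact hc ⟨ℓ, ‹_›, hℓr, fun hg ↦ hno (Or.inl hg), fun hmu ↦ hno (Or.inr hmu)⟩
  -- prime-power divisors supported on one additive prime ℓ
  have hppow : ∀ (ℓ : ℕ) [Fact ℓ.Prime], (¬ W.HasGoodReductionAtPrime ℓ ∧ ¬ W.HasMultiplicativeReductionAtPrime ℓ) →
      ∀ (e : ℕ), (∀ r : ℕ, r.Prime → r ∣ ℓ ^ e →
        (r < 5 ∨ ∃ _ : Fact r.Prime, ¬ W.HasGoodReductionAtPrime r ∧ ¬ W.HasMultiplicativeReductionAtPrime r)) := by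
    intro ℓ iℓ hadd e r hr hre
    have : r = ℓ := (Nat.prime_dvd_prime_iff_eq hr iℓ.out).mp (hr.dvd_of_dvd_pow hre)
    subst this
    exact Or.inr ⟨iℓ, hadd⟩
  -- Case analysis on the 3-locus first
  by_cases h27 : 3 ^ 3 ∣ W.conductorNorm ℤ
  · refine ⟨27, le_rfl, by simpa using h27, hcop 27 ?_⟩
    intro r hr hr27
    have : r = 3 := (Nat.prime_dvd_prime_iff_eq hr Nat.prime_three).mp (hr.dvd_of_dvd_pow (by simpa using hr27 : r ∣ 3 ^ 3))
    omega
  have h3' : ¬ (∀ (ℓ : ℕ) [Fact ℓ.Prime], ℓ ≠ 3 → W.HasGoodReductionAtPrime ℓ ∨ W.HasMultiplicativeReductionAtPrime ℓ) :=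
    fun h ↦ h3 ⟨h, h27⟩
  obtain ⟨ℓ, iℓ, hℓ3, hℓadd⟩ := hex 3 h3'
  have hℓsq : ℓ ^ 2 ∣ W.conductorNorm ℤ := sq_dvd_conductorNorm_of_not_good_of_not_mult hℓadd
  have hℓP : ℓ.Prime := iℓ.out
  -- Sub-case ℓ ≥ 7 (i.e. ℓ ∉ {2, 3, 5}; ℓ ≠ 3 already): ℓ² ≥ 49
  by_cases hℓbig : 7 ≤ ℓ
  · refine ⟨ℓ ^ 2, ?_, hℓsq, hcop _ (hppow ℓ hℓadd 2)⟩
    calc 27 ≤ 7 ^ 2 := by norm_num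
      _ ≤ ℓ ^ 2 := Nat.pow_le_pow_left hℓbig 2
  -- ℓ ∈ {2, 5} (prime, < 7, ≠ 3)
  have hℓ25 : ℓ = 2 ∨ ℓ = 5 := by
    have h2le := hℓP.two_le
    interval_cases ℓ <;> simp_all <;> exact absurd hℓP (by decide)
  rcases hℓ25 with rfl | rfl
  · -- ℓ = 2 additive: 4 ∣ N; use ¬locus₂
    by_cases h32 : 2 ^ 5 ∣ W.conductorNorm ℤ
    · refine ⟨32, by norm_num, by simpa using h32, hcop 32 ?_⟩
      intro r hr hr32
      have : r = 2 := (Nat.prime_dvd_prime_iff_eq hr Nat.prime_two).mp (hr.dvd_of_dvd_pow (by simpa using hr32 : r ∣ 2 ^ 5))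
      omega
    obtain ⟨ℓ', iℓ', hℓ'2, hℓ'add⟩ := hex 2 (fun h ↦ h2 ⟨h, h32⟩)
    have hℓ'sq : ℓ' ^ 2 ∣ W.conductorNorm ℤ := sq_dvd_conductorNorm_of_not_good_of_not_mult hℓ'add
    have hℓ'P : ℓ'.Prime := iℓ'.out
    have hℓ'3 : 3 ≤ ℓ' := by have := hℓ'P.two_le; omega
    -- D = 4 · ℓ'² ≥ 36
    have hcop2 : Nat.Coprime (2 ^ 2) (ℓ' ^ 2) := by
      apply Nat.Coprime.pow
      rw [Nat.coprime_primes Nat.prime_two hℓ'P]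
      omega
    refine ⟨2 ^ 2 * ℓ' ^ 2, ?_, Nat.Coprime.mul_dvd_of_dvd_of_dvd hcop2 ((pow_dvd_pow 2 (by norm_num)).trans hℓsq) hℓ'sq, ?_⟩
    · calc 27 ≤ 2 ^ 2 * 3 ^ 2 := by norm_num
        _ ≤ 2 ^ 2 * ℓ' ^ 2 := Nat.mul_le_mul_left _ (Nat.pow_le_pow_left hℓ'3 2)
    · refine hcop _ (fun r hr hrD ↦ ?_)
      rcases (Nat.Prime.dvd_mul hr).mp hrD with h | h
      · exact hppow 2 hℓadd 2 r hr h
      · exact hppow ℓ' hℓ'add 2 r hr h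
  · -- ℓ = 5 additive: 25 ∣ N; use ¬locus₅
    by_cases h125 : 5 ^ 3 ∣ W.conductorNorm ℤ
    · refine ⟨125, by norm_num, by simpa using h125, hcop 125 (hppow 5 hℓadd 3 ·)⟩
    obtain ⟨ℓ', iℓ', hℓ'5, hℓ'add⟩ := hex 5 (fun h ↦ h5 ⟨h, h125⟩)
    have hℓ'sq : ℓ' ^ 2 ∣ W.conductorNorm ℤ := sq_dvd_conductorNorm_of_not_good_of_not_mult hℓ'add
    have hℓ'P : ℓ'.Prime := iℓ'.out
    have hℓ'2 : 2 ≤ ℓ' := hℓ'P.two_le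
    have hcop5 : Nat.Coprime (5 ^ 2) (ℓ' ^ 2) := by
      apply Nat.Coprime.pow
      rw [Nat.coprime_primes (by norm_num) hℓ'P]
      exact fun h ↦ hℓ'5 h.symm
    refine ⟨5 ^ 2 * ℓ' ^ 2, ?_, Nat.Coprime.mul_dvd_of_dvd_of_dvd hcop5 hℓsq hℓ'sq, ?_⟩
    · calc 27 ≤ 5 ^ 2 * 2 ^ 2 := by norm_num
        _ ≤ 5 ^ 2 * ℓ' ^ 2 := Nat.mul_le_mul_left _ (Nat.pow_le_pow_left hℓ'2 2)
    · refine hcop _ (fun r hr hrD ↦ ?_)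
      rcases (Nat.Prime.dvd_mul hr).mp hrD with h | h
      · exact hppow 5 hℓadd 2 r hr h
      · exact hppow ℓ' hℓ'add 2 r hr h

/-! ### §3 The conductor bound -/

/-- **§3. No residual pair below `966 735`.** `W` elliptic over `ℚ`, `p ≥ 5` a prime of multiplicative reduction, `q₁, q₂, q₃` pairwise distinct primes of
multiplicative reduction with `p ∣ q_i − 1` (so `q_i ≥ 11`, `q_i ≠ p`), and `E` off the three genus-zero additive loci ⟹ `966 735 ≤ N_E`
(`N_E` is divisible by `p·q₁·q₂·q₃ ≥ 35 805` and by a coprime additive divisor `D ≥ 27`). In particular the v10 ∕ v11 residual stubs of line `birth` have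
NO instance with `N_E < 966 735`. [cite: SilvermanATAEC1994, IV.10.2 (c)] -/
theorem conductorNorm_ge_of_threeOneModMult_offGenusZero
    (W : WeierstrassCurve ℚ) [W.IsElliptic] (p : ℕ) [Fact p.Prime] (hp5 : 5 ≤ p) (hMp : Mult W p)
    (q₁ q₂ q₃ : ℕ) [Fact q₁.Prime] [Fact q₂.Prime] [Fact q₃.Prime]
    (h12 : q₁ ≠ q₂) (h13 : q₁ ≠ q₃) (h23 : q₂ ≠ q₃)
    (hM₁ : Mult W q₁) (hM₂ : Mult W q₂) (hM₃ : Mult W q₃)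
    (hd₁ : p ∣ q₁ - 1) (hd₂ : p ∣ q₂ - 1) (hd₃ : p ∣ q₃ - 1)
    (h2 : ¬ ((∀ (ℓ : ℕ) [Fact ℓ.Prime], ℓ ≠ 2 → W.HasGoodReductionAtPrime ℓ ∨ W.HasMultiplicativeReductionAtPrime ℓ) ∧
      ¬ 2 ^ 5 ∣ W.conductorNorm ℤ))
    (h3 : ¬ ((∀ (ℓ : ℕ) [Fact ℓ.Prime], ℓ ≠ 3 → W.HasGoodReductionAtPrime ℓ ∨ W.HasMultiplicativeReductionAtPrime ℓ) ∧
      ¬ 3 ^ 3 ∣ W.conductorNorm ℤ))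
    (h5 : ¬ ((∀ (ℓ : ℕ) [Fact ℓ.Prime], ℓ ≠ 5 → W.HasGoodReductionAtPrime ℓ ∨ W.HasMultiplicativeReductionAtPrime ℓ) ∧
      ¬ 5 ^ 3 ∣ W.conductorNorm ℤ)) :
    966735 ≤ W.conductorNorm ℤ := by
  have hp : p.Prime := Fact.out
  have hq₁ : q₁.Prime := Fact.out
  have hq₂ : q₂.Prime := Fact.out
  have hq₃ : q₃.Prime := Fact.out
  -- sizes: q_i = 2p k + 1 ≥ 11, hence q_i ≠ p
  have hge : ∀ {q : ℕ}, q.Prime → p ∣ q - 1 → 11 ≤ q ∧ q ≠ p := by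
    intro q hq hd
    obtain ⟨k, hk, rfl⟩ := exists_eq_two_mul_mul_add_one hp (by omega) hq hd
    constructor
    · nlinarith
    · intro h
      have : 2 * p * k + 1 ≤ p := h.le
      nlinarith
  obtain ⟨hq₁11, hq₁p⟩ := hge hq₁ hd₁
  obtain ⟨hq₂11, hq₂p⟩ := hge hq₂ hd₂
  obtain ⟨hq₃11, hq₃p⟩ := hge hq₃ hd₃
  -- each multiplicative prime divides the conductor
  have hdvd : ∀ (q : ℕ) [Fact q.Prime], Mult W q → q ∣ W.conductorNorm ℤ := fun q _ hq ↦
    (W.dvd_conductorNorm_iff_not_hasGoodReductionAtPrime q).mpr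
      (WeierstrassCurve.HasMultiplicativeReduction.not_hasGoodReduction (R := ℤ_[q]) hq)
  -- the product p q₁ q₂ q₃ divides N (pairwise coprime primes)
  have hcp : ∀ {a b : ℕ}, a.Prime → b.Prime → a ≠ b → Nat.Coprime a b :=
    fun ha hb hab ↦ (Nat.coprime_primes ha hb).mpr hab
  have hP : p * q₁ * q₂ * q₃ ∣ W.conductorNorm ℤ := by
    have h1 : p * q₁ ∣ W.conductorNorm ℤ :=
      Nat.Coprime.mul_dvd_of_dvd_of_dvd (hcp hp hq₁ (Ne.symm hq₁p)) (hdvd p hMp) (hdvd q₁ hM₁)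
    have h2 : p * q₁ * q₂ ∣ W.conductorNorm ℤ :=
      Nat.Coprime.mul_dvd_of_dvd_of_dvd
        (Nat.Coprime.mul_left (hcp hp hq₂ (Ne.symm hq₂p)) (hcp hq₁ hq₂ h12)) h1 (hdvd q₂ hM₂)
    exact Nat.Coprime.mul_dvd_of_dvd_of_dvd
      (Nat.Coprime.mul_left (Nat.Coprime.mul_left (hcp hp hq₃ (Ne.symm hq₃p)) (hcp hq₁ hq₃ h13)) (hcp hq₂ hq₃ h23))
      h2 (hdvd q₃ hM₃)
  -- the additive divisor D ≥ 27, coprime to p q₁ q₂ q₃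
  have hm : ∀ r : ℕ, r.Prime → r ∣ p * q₁ * q₂ * q₃ → 5 ≤ r ∧ ∃ _ : Fact r.Prime, Mult W r := by
    intro r hr hrm
    rcases (Nat.Prime.dvd_mul hr).mp hrm with h | h
    · rcases (Nat.Prime.dvd_mul hr).mp h with h | h
      · rcases (Nat.Prime.dvd_mul hr).mp h with h | h
        · have := (Nat.prime_dvd_prime_iff_eq hr hp).mp h; subst this; exact ⟨hp5, ‹_›, hMp⟩
        · have := (Nat.prime_dvd_prime_iff_eq hr hq₁).mp h; subst this; exact ⟨by omega, ‹_›, hM₁⟩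
      · have := (Nat.prime_dvd_prime_iff_eq hr hq₂).mp h; subst this; exact ⟨by omega, ‹_›, hM₂⟩
    · have := (Nat.prime_dvd_prime_iff_eq hr hq₃).mp h; subst this; exact ⟨by omega, ‹_›, hM₃⟩
  obtain ⟨D, hD27, hDN, hDcop⟩ := exists_additive_divisor_ge_twentySeven W h2 h3 h5 (p * q₁ * q₂ * q₃) hm
  have hDP : D * (p * q₁ * q₂ * q₃) ∣ W.conductorNorm ℤ := Nat.Coprime.mul_dvd_of_dvd_of_dvd hDcop hDN hP
  have hN0 : 0 < W.conductorNorm ℤ := W.conductorNorm_pos_holds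
  have hprod : 35805 ≤ p * q₁ * q₂ * q₃ := prod_ge_of_three_distinct_one_mod hp hp5 hq₁ hq₂ hq₃ h12 h13 h23 hd₁ hd₂ hd₃
  calc 966735 = 27 * 35805 := by norm_num
    _ ≤ D * (p * q₁ * q₂ * q₃) := Nat.mul_le_mul hD27 hprod
    _ ≤ W.conductorNorm ℤ := Nat.le_of_dvd hN0 hDP

/-- **Corollary: no residual pair in Cremona's range `N < 5·10⁵`** (the census range of the line's kit j254667): `500 000 < N_E`. -/
theorem conductorNorm_gt_cremona_of_threeOneModMult_offGenusZero
    (W : WeierstrassCurve ℚ) [W.IsElliptic] (p : ℕ) [Fact p.Prime] (hp5 : 5 ≤ p) (hMp : Mult W p)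
    (q₁ q₂ q₃ : ℕ) [Fact q₁.Prime] [Fact q₂.Prime] [Fact q₃.Prime]
    (h12 : q₁ ≠ q₂) (h13 : q₁ ≠ q₃) (h23 : q₂ ≠ q₃)
    (hM₁ : Mult W q₁) (hM₂ : Mult W q₂) (hM₃ : Mult W q₃)
    (hd₁ : p ∣ q₁ - 1) (hd₂ : p ∣ q₂ - 1) (hd₃ : p ∣ q₃ - 1)
    (h2 : ¬ ((∀ (ℓ : ℕ) [Fact ℓ.Prime], ℓ ≠ 2 → W.HasGoodReductionAtPrime ℓ ∨ W.HasMultiplicativeReductionAtPrime ℓ) ∧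
      ¬ 2 ^ 5 ∣ W.conductorNorm ℤ))
    (h3 : ¬ ((∀ (ℓ : ℕ) [Fact ℓ.Prime], ℓ ≠ 3 → W.HasGoodReductionAtPrime ℓ ∨ W.HasMultiplicativeReductionAtPrime ℓ) ∧
      ¬ 3 ^ 3 ∣ W.conductorNorm ℤ))
    (h5 : ¬ ((∀ (ℓ : ℕ) [Fact ℓ.Prime], ℓ ≠ 5 → W.HasGoodReductionAtPrime ℓ ∨ W.HasMultiplicativeReductionAtPrime ℓ) ∧
      ¬ 5 ^ 3 ∣ W.conductorNorm ℤ)) :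
    500000 < W.conductorNorm ℤ :=
  lt_of_lt_of_le (by norm_num)
    (conductorNorm_ge_of_threeOneModMult_offGenusZero W p hp5 hMp q₁ q₂ q₃ h12 h13 h23 hM₁ hM₂ hM₃ hd₁ hd₂ hd₃ h2 h3 h5)

end Summit.BirchSwinnertonDyer.BirchSwinnertonDyer.Theorems.EulerHalfResidualBound

end
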